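import Literature.Computability.QuantumComplexity.KeyedOracleBlocksFamily
import Literature.Computability.QuantumComplexity.KeyedOracleFamilyUniform
import Literature.Computability.Complexity.CodeFPBudgets
import HarnessLib

/-!
# The keyed-oracle BLOCKS family is polynomial-time UNIFORM (given its block gate lists on codes)

Topic `Literature/Computability/QuantumComplexity`; sequel of `KeyedOracleBlocksFamily.lean` (`KeyedBlocks.family`: Hadamards on
the `κOf L` key wires, then for each block `b < MOf L` the block gate list `blockGates L b` re-targeted to the prefix wires
— parameter wires `M·n … L−1` and key wires — and transported to block `b`, whose input wire `i < n` is `b·n + i` and whose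
ancilla `n + j` is `L + b·m + j`) and of `KeyedOracleFamilyUniform.lean` (the one-block case `KeyedRun.family_isUniform`).
For a uniform oracle algorithm `F`, size functions `nOf, MOf, κOf` computed in polynomial time on unary numerals, and block
gate lists whose RAW form (`QGate.toRaw`) is computed in polynomial time from `(1^L, b)`, the blocks family is polynomial-
time uniform: its description is printed from `1^L` gate by gate (Arora–Barak 2009, §6.2 Remark 6.7: uniformity = the
description function is in `FP`; Bennett–Bernstein–Brassard–Vazirani 1997, Thm. 4.14: inserting subroutine calls is a
polynomial-time transformation of descriptions). The transducer is assembled in the typed `FP` algebra `CodeFP`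
(`Complexity/CodeFP.lean`) at the level of raw descriptions, ORACLE GATES INCLUDED.

* `KeyedBlocks.embB`, `retargetRawB`, **`rawDescB`** — the raw description of the blocks family as an explicit function of
  `(n, L, m_F, κ, M)` and the raw block gate lists; `ofFn_pre_val`, `toRaw_retargetGate`, **`rawDesc_family`** (it IS the raw
  description of `KeyedBlocks.family`);
* `codeFP_embB`, `codeFP_retargetRawB`, **`codeFP_rawDescB`** — computed on codes;
* **`KeyedBlocks.family_isUniform_of_raw`** — uniformity from `F.IsUniform`, `CodeFP unE unE nOf/MOf/κOf` and a `CodeFP`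
  witness for the raw block gate lists.

Everything here is PROVED; the definitions are explicit list functions.

## References

* C. H. Bennett, E. Bernstein, G. Brassard, U. Vazirani, *Strengths and weaknesses of quantum computing*, SIAM J.
  Comput. 26 (1997) 1510–1523, Thm. 4.14, §4 [BennettBernsteinBrassardVazirani1997].
* S. Arora, B. Barak, *Computational Complexity: A Modern Approach*, CUP 2009, §1.3, §6.1–6.2 and Remark 6.7 [AroraBarak2009].
* M. A. Nielsen, I. L. Chuang, *Quantum Computation and Quantum Information*, CUP 2010, §4.3 [NielsenChuang2010].
-/

noncomputable section

namespace Literature.Computability.QuantumComplexity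

open _root_.Computability Complexity Complexity.Brick Cryptography
open CodeFP

namespace KeyedBlocks

/-! ### The raw description of the blocks family -/

/-- **The wire relabelling of block `b`** on wire INDICES: `i ↦ b·n + i` for `i < n`, else `L + b·m + (i − n)` (the value
of `KeyedBlocks.E`). [cite: AroraBarak2009, §6.1 (descriptions of circuits: wire indices)] -/
def embB (n L m b : ℕ) (i : ℕ) : ℕ := if i < n then b * n + i else L + b * m + (i - n)

/-- **Raw re-targeting of one raw gate of block `b`**: a gate symbol keeps its numeral and moves its wires along `embB`; an
oracle query on `k` wires becomes the query on `(L − M·n) + κ + k` wires, the prefix wires (`KeyedRun.preList (M·n) L (M·m) κ`)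
first. [cite: BennettBernsteinBrassardVazirani1997, Thm. 4.14 (inserting the subroutine calls in the description)] -/
def retargetRawB (n L m κ M b : ℕ) (γ : RawGate) : RawGate :=
  if γ.1 then (true, ((L - M * n) + κ) + γ.2.1, KeyedRun.preList (M * n) L (M * m) κ ++ γ.2.2.map (embB n L m b))
  else (false, γ.2.1, γ.2.2.map (embB n L m b))

variable (P : KeyedBlocks)

/-- **The raw description of the blocks family on instances of length `L`**, given the raw block gate lists `g L b`:
the raw Hadamard layer on the key wires `L + M·m + j`, then the re-targeted raw block lists, block by block.
[cite: AroraBarak2009, §6.1–6.2] -/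
def rawDescB (g : ℕ → ℕ → List RawGate) (L : ℕ) : RawDesc :=
  (L, P.anc L, KeyedRun.hadRaw L (P.MOf L * P.mF L) (P.κOf L) ++
    ((List.range (P.MOf L)).map fun b =>
      (g L b).map (retargetRawB (P.nOf L) L (P.mF L) (P.κOf L) (P.MOf L) b)).flatten)

/-- The prefix wire list is the list of values of `pre`. [cite: AroraBarak2009, §6.1] -/
theorem ofFn_pre_val (L : ℕ) :
    (List.ofFn fun a : Fin ((L - P.MOf L * P.nOf L) + P.κOf L) => ((P.pre L a : Fin (L + P.anc L)) : ℕ)) =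
      KeyedRun.preList (P.MOf L * P.nOf L) L (P.MOf L * P.mF L) (P.κOf L) := by
  rw [List.ofFn_add, KeyedRun.preList]
  congr 1
  · apply List.ext_getElem
    · simp
    · intro i h1 h2
      simp only [List.getElem_ofFn, List.getElem_map, List.getElem_range]
      rw [pre_val]
      simp only [List.length_ofFn] at h1
      simp [h1]
  · apply List.ext_getElem
    · simp
    · intro i h1 h2
      simp only [List.getElem_ofFn, List.getElem_map, List.getElem_range]
      rw [pre_val]
      simp

/-- **The raw gate of a re-targeted gate of block `b` is the raw re-targeting of its raw gate.**
[cite: BennettBernsteinBrassardVazirani1997, Thm. 4.14] -/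
theorem toRaw_retargetGate (L : ℕ) (b : Fin (P.MOf L)) (γ : QGate cliffordT (P.nOf L + P.mF L)) :
    (retargetGate (P.pre L) (P.E L b) (P.pre_ne_E L b) γ).toRaw =
      retargetRawB (P.nOf L) L (P.mF L) (P.κOf L) (P.MOf L) b γ.toRaw := by
  cases γ with
  | gate g e =>
    simp only [retargetGate, QGate.toRaw, retargetRawB, List.map_ofFn]
    simp only [Bool.false_eq_true, ↓reduceIte, Prod.mk.injEq, true_and]
    refine List.ofFn_inj.2 (funext fun i => ?_)
    simp only [Function.comp_apply, Function.Embedding.trans_apply, E_val, embB]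
  | oracle k e =>
    simp only [retargetGate, QGate.toRaw, retargetRawB, ↓reduceIte, Prod.mk.injEq, true_and]
    rw [← ofFn_pre_val, List.map_ofFn]
    refine (KeyedRun.ofFn_prefEmb_val (P.pre L) (e.trans (P.E L b)) fun a c => P.pre_ne_E L b a (e c)).trans ?_
    congr 1

/-- Mapping over `finRange` is mapping over `range` through the values. [folklore] -/
private theorem map_finRange_eq_map_range {α : Type} {M : ℕ} (f : Fin M → α) (g : ℕ → α) (h : ∀ b : Fin M, f b = g b) :
    (List.finRange M).map f = (List.range M).map g := by
  apply List.ext_getElem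
  · simp
  · intro i h1 h2
    simp only [List.getElem_map, List.getElem_finRange, List.getElem_range]
    exact h _

/-- **`rawDescB` is the raw description of the blocks family** when `g` lists the raw block gates.
[cite: AroraBarak2009, §6.1–6.2] -/
theorem rawDesc_family (g : ℕ → ℕ → List RawGate) (hg : ∀ (L : ℕ) (b : Fin (P.MOf L)), g L b = (P.blockGates L b).map QGate.toRaw)
    (L : ℕ) : P.family.rawDesc L = P.rawDescB g L := by
  simp only [QCircuitFamily.rawDesc, rawDescB]
  refine congrArg _ (congrArg _ ?_)
  change ((List.ofFn ((P.keyT L).trans (P.pre L))).map hOn ++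
    (List.finRange (P.MOf L)).flatMap fun b => retarget (P.pre L) (P.E L b) (P.pre_ne_E L b) (P.blockGates L b)).map
      QGate.toRaw = _
  rw [List.map_append]
  congr 1
  · rw [KeyedRun.hadRaw, List.map_map, List.map_ofFn]
    apply List.ext_getElem
    · simp
    · intro i h1 h2
      rw [List.getElem_ofFn, List.getElem_map, List.getElem_range]
      simp only [Function.comp_apply, KeyedRun.toRaw_hOn', keyT_trans_pre_val]
  · rw [List.map_flatMap, List.flatMap_def]
    congr 1
    refine map_finRange_eq_map_range _ _ fun b => ?_
    rw [retarget, List.map_map, hg L b, List.map_map]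
    refine List.map_congr_left fun γ _ => ?_
    simp only [Function.comp_apply, toRaw_retargetGate]

/-! ### The raw description is computed on codes -/

/-- The code of the block context `(n, L, m, b)`. [cite: AroraBarak2009, §1.3] -/
abbrev bctxE : ℕ × ℕ × ℕ × ℕ → List Bool := pairE natE (pairE natE (pairE natE natE))

/-- `embB` is computed on codes (context `(n, L, m, b)`, argument the wire index). [cite: AroraBarak2009, §1.3] -/
theorem codeFP_embB : CodeFP (pairE bctxE natE) natE (fun p : (ℕ × ℕ × ℕ × ℕ) × ℕ => embB p.1.1 p.1.2.1 p.1.2.2.1 p.1.2.2.2 p.2) := by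
  have hn : CodeFP (pairE bctxE natE) natE (fun p : (ℕ × ℕ × ℕ × ℕ) × ℕ => p.1.1) := (fst _ _).fst'
  have hL : CodeFP (pairE bctxE natE) natE (fun p : (ℕ × ℕ × ℕ × ℕ) × ℕ => p.1.2.1) := (fst _ _).snd'.fst'
  have hm : CodeFP (pairE bctxE natE) natE (fun p : (ℕ × ℕ × ℕ × ℕ) × ℕ => p.1.2.2.1) := (fst _ _).snd'.snd'.fst'
  have hb : CodeFP (pairE bctxE natE) natE (fun p : (ℕ × ℕ × ℕ × ℕ) × ℕ => p.1.2.2.2) := (fst _ _).snd'.snd'.snd'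
  have hi : CodeFP (pairE bctxE natE) natE (fun p : (ℕ × ℕ × ℕ × ℕ) × ℕ => p.2) := snd _ _
  have hc : CodeFP (pairE bctxE natE) bitE (fun p : (ℕ × ℕ × ℕ × ℕ) × ℕ => decide (p.2 < p.1.1)) :=
    natLt.comp (hi.pair hn)
  have ht : CodeFP (pairE bctxE natE) natE (fun p : (ℕ × ℕ × ℕ × ℕ) × ℕ => p.1.2.2.2 * p.1.1 + p.2) :=
    natAdd.comp ((natMul.comp (hb.pair hn)).pair hi)
  have he : CodeFP (pairE bctxE natE) natE
      (fun p : (ℕ × ℕ × ℕ × ℕ) × ℕ => p.1.2.1 + p.1.2.2.2 * p.1.2.2.1 + (p.2 - p.1.1)) :=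
    natAdd.comp ((natAdd.comp (hL.pair (natMul.comp (hb.pair hm)))).pair (natSub.comp (hi.pair hn)))
  exact (hc.ite ht he).congr fun p => by simp [embB]

/-- The code of the context of the gate map: `(prefix list, (oracle arity offset A, (n, L, m, b)))`. [cite: AroraBarak2009, §1.3] -/
abbrev gctxE : List ℕ × (ℕ × (ℕ × ℕ × ℕ × ℕ)) → List Bool := pairE (rawE natE) (pairE natE bctxE)

/-- **Raw re-targeting is computed on codes** (context: the prefix list and the arity offset `A = (L − M·n) + κ` — both
precomputed — and `(n, L, m, b)`). [cite: BennettBernsteinBrassardVazirani1997, Thm. 4.14] [cite: AroraBarak2009, §1.3] -/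
theorem codeFP_retargetRawB :
    CodeFP (pairE gctxE RawGate.E) RawGate.E
      (fun p : (List ℕ × (ℕ × (ℕ × ℕ × ℕ × ℕ))) × RawGate =>
        if p.2.1 then (true, p.1.2.1 + p.2.2.1, p.1.1 ++ p.2.2.2.map (embB p.1.2.2.1 p.1.2.2.2.1 p.1.2.2.2.2.1 p.1.2.2.2.2.2))
        else (false, p.2.2.1, p.2.2.2.map (embB p.1.2.2.1 p.1.2.2.2.1 p.1.2.2.2.2.1 p.1.2.2.2.2.2))) := by
  have hpl : CodeFP (pairE gctxE RawGate.E) (rawE natE)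
      (fun p : (List ℕ × (ℕ × (ℕ × ℕ × ℕ × ℕ))) × RawGate => p.1.1) := (fst _ _).fst'
  have hA : CodeFP (pairE gctxE RawGate.E) natE
      (fun p : (List ℕ × (ℕ × (ℕ × ℕ × ℕ × ℕ))) × RawGate => p.1.2.1) := (fst _ _).snd'.fst'
  have hctx : CodeFP (pairE gctxE RawGate.E) bctxE
      (fun p : (List ℕ × (ℕ × (ℕ × ℕ × ℕ × ℕ))) × RawGate => p.1.2.2) := (fst _ _).snd'.snd'
  have hγ : CodeFP (pairE gctxE RawGate.E) RawGate.E
      (fun p : (List ℕ × (ℕ × (ℕ × ℕ × ℕ × ℕ))) × RawGate => p.2) := snd _ _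
  have htag : CodeFP (pairE gctxE RawGate.E) bitE
      (fun p : (List ℕ × (ℕ × (ℕ × ℕ × ℕ × ℕ))) × RawGate => p.2.1) := RawGate.codeFP_tag.comp hγ
  have hbody : CodeFP (pairE gctxE RawGate.E) (pairE natE (listE natE))
      (fun p : (List ℕ × (ℕ × (ℕ × ℕ × ℕ × ℕ))) × RawGate => p.2.2) := RawGate.codeFP_body.comp hγ
  have hnum : CodeFP (pairE gctxE RawGate.E) natE
      (fun p : (List ℕ × (ℕ × (ℕ × ℕ × ℕ × ℕ))) × RawGate => p.2.2.1) := hbody.fst'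
  have hws : CodeFP (pairE gctxE RawGate.E) (rawE natE)
      (fun p : (List ℕ × (ℕ × (ℕ × ℕ × ℕ × ℕ))) × RawGate => p.2.2.2) := (rawOfList natE).comp hbody.snd'
  have hmoved : CodeFP (pairE gctxE RawGate.E) (rawE natE)
      (fun p : (List ℕ × (ℕ × (ℕ × ℕ × ℕ × ℕ))) × RawGate =>
        p.2.2.2.map (embB p.1.2.2.1 p.1.2.2.2.1 p.1.2.2.2.2.1 p.1.2.2.2.2.2)) :=
    ((map codeFP_embB).comp (hctx.pair hws)).congr fun p => rfl
  have hnum' : CodeFP (pairE gctxE RawGate.E) natE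
      (fun p : (List ℕ × (ℕ × (ℕ × ℕ × ℕ × ℕ))) × RawGate => p.1.2.1 + p.2.2.1) := natAdd.comp (hA.pair hnum)
  have hws' : CodeFP (pairE gctxE RawGate.E) (listE natE)
      (fun p : (List ℕ × (ℕ × (ℕ × ℕ × ℕ × ℕ))) × RawGate =>
        p.1.1 ++ p.2.2.2.map (embB p.1.2.2.1 p.1.2.2.2.1 p.1.2.2.2.2.1 p.1.2.2.2.2.2)) :=
    (listOfRaw natE).comp ((rawAppend natE).comp (hpl.pair hmoved))
  have hthen : CodeFP (pairE gctxE RawGate.E) RawGate.E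
      (fun p : (List ℕ × (ℕ × (ℕ × ℕ × ℕ × ℕ))) × RawGate =>
        ((true, p.1.2.1 + p.2.2.1,
          p.1.1 ++ p.2.2.2.map (embB p.1.2.2.1 p.1.2.2.2.1 p.1.2.2.2.2.1 p.1.2.2.2.2.2)) : RawGate)) :=
    (RawGate.codeFP_mk.comp ((const _ true).pair (hnum'.pair hws'))).congr fun p => rfl
  have helse : CodeFP (pairE gctxE RawGate.E) RawGate.E
      (fun p : (List ℕ × (ℕ × (ℕ × ℕ × ℕ × ℕ))) × RawGate =>
        ((false, p.2.2.1, p.2.2.2.map (embB p.1.2.2.1 p.1.2.2.2.1 p.1.2.2.2.2.1 p.1.2.2.2.2.2)) : RawGate)) :=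
    (RawGate.codeFP_mk.comp ((const _ false).pair (hnum.pair ((listOfRaw natE).comp hmoved)))).congr fun p => rfl
  exact (htag.ite hthen helse).congr fun p => rfl

/-- Unary multiplication on codes. [cite: AroraBarak2009, §1.3] -/
theorem codeFP_unMul : CodeFP (pairE unE unE) unE (fun p : ℕ × ℕ => p.1 * p.2) :=
  ((ulength unitE).comp (unitsMul.comp ((replicateUnit.comp (fst _ _)).pair (replicateUnit.comp (snd _ _))))).congr
    fun p => by simp

/-- **The raw description of the blocks family is computed on codes from `1^L`** (for uniform `F`, size functions computed
on unary codes, and raw block gate lists computed on codes from `(1^L, b)`).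
[cite: AroraBarak2009, §6.2 Remark 6.7] [cite: BennettBernsteinBrassardVazirani1997, Thm. 4.14] -/
theorem codeFP_rawDescB (hF : P.F.IsUniform) (hn : CodeFP unE unE P.nOf) (hM : CodeFP unE unE P.MOf)
    (hκ : CodeFP unE unE P.κOf) {g : ℕ → ℕ → List RawGate}
    (hg : CodeFP (pairE unE natE) (rawE RawGate.E) (fun p : ℕ × ℕ => g p.1 p.2)) :
    CodeFP unE RawDesc.E (P.rawDescB g) := by
  -- the ancilla count of one block, in unary
  have hmU : CodeFP unE unE (fun L => P.mF L) := (((codeFP_rawDesc hF).comp hn).snd'.fst').congr fun L => rfl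
  -- `M·n` and `M·m` in unary
  have hMn : CodeFP unE unE (fun L => P.MOf L * P.nOf L) := codeFP_unMul.comp (hM.pair hn)
  have hMm : CodeFP unE unE (fun L => P.MOf L * P.mF L) := codeFP_unMul.comp (hM.pair hmU)
  -- the prefix context `(M·n, L, M·m, κ)` in binary and the unary budget `L + κ`
  have hpctx : CodeFP unE KeyedRun.ctxE (fun L => (P.MOf L * P.nOf L, L, P.MOf L * P.mF L, P.κOf L)) :=
    (natOfUn.comp hMn).pair (natOfUn.pair ((natOfUn.comp hMm).pair (natOfUn.comp hκ)))
  have hbud : CodeFP unE unE (fun L => L + P.κOf L) := unAdd.comp ((CodeFP.id unE).pair hκ)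
  have hmin1 : ∀ L, min (L - P.MOf L * P.nOf L) (L + P.κOf L) = L - P.MOf L * P.nOf L := fun L => min_eq_left (by omega)
  have hmin2 : ∀ L, min (P.κOf L) (L + P.κOf L) = P.κOf L := fun L => min_eq_left (by omega)
  have hpl : CodeFP unE (rawE natE) (fun L => KeyedRun.preList (P.MOf L * P.nOf L) L (P.MOf L * P.mF L) (P.κOf L)) :=
    (KeyedRun.codeFP_preList.comp (hbud.pair hpctx)).congr fun L => by simp only [KeyedRun.preList, hmin1, hmin2]
  have hhad : CodeFP unE (rawE RawGate.E) (fun L => KeyedRun.hadRaw L (P.MOf L * P.mF L) (P.κOf L)) :=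
    (KeyedRun.codeFP_hadRaw.comp (hbud.pair hpctx)).congr fun L => by simp only [KeyedRun.hadRaw, hmin2]
  -- the arity offset `A = (L − M·n) + κ`
  have hA : CodeFP unE natE (fun L => (L - P.MOf L * P.nOf L) + P.κOf L) :=
    natAdd.comp ((natSub.comp (natOfUn.pair (natOfUn.comp hMn))).pair (natOfUn.comp hκ))
  -- the block map: context `σ = L` (unary), item `b` (binary)
  have sL : CodeFP (pairE unE natE) unE (fun q : ℕ × ℕ => q.1) := fst _ _
  have sb : CodeFP (pairE unE natE) natE (fun q : ℕ × ℕ => q.2) := snd _ _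
  have hbctx : CodeFP (pairE unE natE) bctxE (fun q : ℕ × ℕ => (P.nOf q.1, q.1, P.mF q.1, q.2)) :=
    ((natOfUn.comp hn).comp sL).pair ((natOfUn.comp sL).pair (((natOfUn.comp hmU).comp sL).pair sb))
  have hgctx : CodeFP (pairE unE natE) gctxE
      (fun q : ℕ × ℕ => (KeyedRun.preList (P.MOf q.1 * P.nOf q.1) q.1 (P.MOf q.1 * P.mF q.1) (P.κOf q.1),
        ((q.1 - P.MOf q.1 * P.nOf q.1) + P.κOf q.1, (P.nOf q.1, q.1, P.mF q.1, q.2)))) :=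
    (hpl.comp sL).pair ((hA.comp sL).pair hbctx)
  have hblock : CodeFP (pairE unE natE) (rawE RawGate.E)
      (fun q : ℕ × ℕ => (g q.1 q.2).map (retargetRawB (P.nOf q.1) q.1 (P.mF q.1) (P.κOf q.1) (P.MOf q.1) q.2)) :=
    ((map codeFP_retargetRawB).comp (hgctx.pair hg)).congr fun q => by
      refine List.map_congr_left fun γ _ => ?_
      simp only [retargetRawB]
  have hblocks : CodeFP unE (rawE (rawE RawGate.E))
      (fun L => (List.range (P.MOf L)).map fun b =>
        (g L b).map (retargetRawB (P.nOf L) L (P.mF L) (P.κOf L) (P.MOf L) b)) :=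
    ((map hblock).comp ((CodeFP.id unE).pair (urange.comp hM))).congr fun L => rfl
  have hanc : CodeFP unE unE (fun L => P.anc L) := (unAdd.comp (hMm.pair hκ)).congr fun L => rfl
  exact (natOfUn.pair (hanc.pair ((rawAppend RawGate.E).comp (hhad.pair ((flatten RawGate.E).comp hblocks))))).congr
    fun L => rfl

/-- **The keyed-oracle blocks family is polynomial-time uniform** for a uniform oracle algorithm `F`, size functions
`nOf, MOf, κOf` computed in polynomial time on unary numerals, and block gate lists whose raw form is computed in polynomial
time from `(1^L, b)`. [cite: BennettBernsteinBrassardVazirani1997, Thm. 4.14] [cite: AroraBarak2009, §6.2 Remark 6.7] -/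
theorem family_isUniform_of_raw (hF : P.F.IsUniform) (hn : CodeFP unE unE P.nOf) (hM : CodeFP unE unE P.MOf)
    (hκ : CodeFP unE unE P.κOf) {g : ℕ → ℕ → List RawGate}
    (hg : CodeFP (pairE unE natE) (rawE RawGate.E) (fun p : ℕ × ℕ => g p.1 p.2))
    (hgB : ∀ (L : ℕ) (b : Fin (P.MOf L)), g L b = (P.blockGates L b).map QGate.toRaw) :
    P.family.IsUniform := by
  rw [QCircuitFamily.isUniform_iff_descFn_mem_FP]
  obtain ⟨f, hf, hfe⟩ := P.codeFP_rawDescB hF hn hM hκ hg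
  have h : P.family.descFn = f ∘ onesFn := funext fun z => by
    rw [Function.comp_apply, QCircuitFamily.descFn_eq_E_rawDesc, onesFn, P.rawDesc_family g hgB, ← hfe]
  rw [h]
  exact comp_mem_FP hf onesFn_mem_FP

end KeyedBlocks

end Literature.Computability.QuantumComplexity

end
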